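import Literature.Barriers.PneNP.MatchingPolytopeExtensionComplexity
import HarnessLib

/-!
# Edmonds' description as an extended formulation: `xc(P_PM(K_n)) ≤ xc(P_M(K_n)) ≤ 2^{n+1}`,
# so `xc(P_PM(K_n)) = 2^{Θ(n)}` (Edmonds 1965; Rothvoß 2017, §1)

T. Rothvoß, *The matching polytope has exponential extension complexity*, J. ACM 64 (2017) =
arXiv:1311.2369 [Rothvoss2017], §1 (PDF p. 4), on Edmonds' description [Edmonds1965] of the matching
polytopes, verbatim (L7–9, L17–18, L26–27):

> "A well-known work of Edmonds shows that apart from requiring non-negativity, the degree-constraints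
> plus the odd-set inequalities are enough for an inequality description. […] Note that there are only
> `n` degree constraints and `O(n²)` non-negativity constraints, but `2^{Ω(n)}` odd set inequalities.
> […] Moreover, the best known upper bound on the extension complexity in general graphs is
> `poly(n) · 2^{n/2}` [Faenza–Fiorini–Grappe–Tiwary 2012]".

An inequality description with `N` inequalities IS an extended formulation of size `N` (the slack form;
Braun–Pokutta [BraunPokutta2014] §2.2.1: "This linear program provides an LP formulation", the tree's
`hasEFOfSize_of_inequalities`).  This file PROVES (no named facts) the resulting TRIVIAL upper bound
— not the sharper `poly(n)·2^{n/2}` of FFGT 2012, which needs Balas' union formulation over a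
covering family of bipartitions:

* `edmondsPolytope_eq_setOf_dotProduct` — Edmonds' `P_M(G)` (the tree's `edmondsPolytope G`:
  `x ≥ 0`, `x(δ(v)) ≤ 1`, `x(E[S]) ≤ (|S|−1)/2` for odd `S`) as a system `c_a · x ≤ d_a` indexed by
  `E ⊕ V ⊕ {S ⊆ V : |S| odd}`;
* `hasEFOfSize_edmondsPolytope_card` — `xc(P_M(G)) ≤ |E| + |V| + #{S ⊆ V : |S| odd}`, and
  `hasEFOfSize_edmondsPolytope_le` — `≤ |E| + |V| + 2^{|V|}`;
* **`hasEFOfSize_edmondsPolytope_top`** — `xc(P_M(K_n)) ≤ C(n,2) + n + 2^n ≤ 2^{n+1}`, and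
  **`hasEFOfSize_pmPolytope_two_pow`** — `xc(P_PM(K_n)) ≤ 2^{n+1}` (the face `P_PM = P_M ∩ {Σ x = n/2}`,
  `HasEFOfSize.pmPolytope_of_edmondsPolytope`);
* **`Rothvoss2017_thm1_theta`** — together with Rothvoß's Theorem 1 (tree theorem
  `Rothvoss2017_thm1`): `xc(P_PM(K_n)) = 2^{Θ(n)}` on even `n`, i.e. `∃ c > 0`, eventually
  `2^{cn} ≤ xc(P_PM(K_n)) ≤ 2^{n+1}` in the `HasEFOfSize` currency.

WHAT THIS IS NOT: not the `poly(n)·2^{n/2}` bound; nothing on psd lifts; nothing on P versus NP.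

## References

* [Edmonds1965] J. Edmonds, *Maximum matching and a polyhedron with 0,1-vertices*, J. Res. Nat. Bur.
  Standards 69B (1965) 125–130 — §2 (1)–(3) (pp. 125–126) (tree: `EdmondsMatchingPolytope.lean`).
* [Rothvoss2017] T. Rothvoß, *The matching polytope has exponential extension complexity*, J. ACM 64
  (2017) Art. 41, doi:10.1145/3127497, arXiv:1311.2369 — §1 (PDF p. 4, L7–9, L17–18, L26–27), Thm. 1.
* [BraunPokutta2014] G. Braun, S. Pokutta, *The matching polytope does not admit fully-polynomial size
  relaxation schemes*, SODA 2015, arXiv:1403.6710 — §2.2.1 (p0007 L100–122) (tree: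
  `hasEFOfSize_of_inequalities`).
-/

noncomputable section

open Finset Matrix Filter

namespace Literature.Barriers.PneNP

open Literature.Combinatorics.Optimization Literature.Combinatorics.Optimization.StephenTuncel1999

section General

variable {V : Type} [Fintype V] [DecidableEq V] (G : SimpleGraph V) [DecidableRel G.Adj]

/-- **The index set of Edmonds' inequalities**: one nonnegativity constraint per edge, one degree
constraint per vertex, one odd-set ("blossom") constraint per odd vertex set.
[cite: Edmonds1965, §2 (1)–(3) (pp. 125–126)] [cite: Rothvoss2017, §1 (PDF p. 4, L17–18)] -/
abbrev EdmondsIndex : Type := G.edgeSet ⊕ V ⊕ {S : Finset V // Odd S.card}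

/-- The left-hand sides `c_a` of Edmonds' inequalities `c_a · x ≤ d_a`: `−e_e`, the incidence vector
of the star `δ(v)`, the incidence vector of `E[S]`. [cite: Edmonds1965, §2 (1)–(3) (pp. 125–126)] -/
def edmondsLHS : EdmondsIndex G → (G.edgeSet → ℝ)
  | Sum.inl e => -Pi.single e 1
  | Sum.inr (Sum.inl v) => fun e => if v ∈ (e : Sym2 V) then 1 else 0
  | Sum.inr (Sum.inr S) => fun e => if e ∈ edgesIn G S.1 then 1 else 0

/-- The right-hand sides `d_a`: `0`, `1`, `(|S| − 1)/2`. [cite: Edmonds1965, §2 (1)–(3) (pp. 125–126)] -/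
def edmondsRHS : EdmondsIndex G → ℝ
  | Sum.inl _ => 0
  | Sum.inr (Sum.inl _) => 1
  | Sum.inr (Sum.inr S) => (((S.1.card - 1) / 2 : ℕ) : ℝ)

/-- **Edmonds' polyhedron as a finite inequality system** `{x | c_a · x ≤ d_a, a ∈ E ⊕ V ⊕ 𝒪}`.
[cite: Edmonds1965, §2 (1)–(3) (pp. 125–126)] -/
theorem edmondsPolytope_eq_setOf_dotProduct :
    edmondsPolytope G = {x | ∀ a, edmondsLHS G a ⬝ᵥ x ≤ edmondsRHS G a} := by
  ext x
  simp only [Set.mem_setOf_eq]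
  have hE : ∀ e : G.edgeSet, edmondsLHS G (Sum.inl e) ⬝ᵥ x = -x e := fun e => by
    simp only [edmondsLHS, neg_dotProduct, single_dotProduct, one_mul]
  have hV : ∀ v : V, edmondsLHS G (Sum.inr (Sum.inl v)) ⬝ᵥ x =
      ∑ e ∈ univ.filter (fun e : G.edgeSet => v ∈ (e : Sym2 V)), x e := fun v => by
    simp only [edmondsLHS, dotProduct, ite_mul, one_mul, zero_mul]
    rw [Finset.sum_filter]
  have hS : ∀ S : {S : Finset V // Odd S.card}, edmondsLHS G (Sum.inr (Sum.inr S)) ⬝ᵥ x =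
      ∑ e ∈ edgesIn G S.1, x e := fun S => by
    simp only [edmondsLHS, dotProduct, ite_mul, one_mul, zero_mul]
    rw [Finset.sum_ite_mem, Finset.univ_inter]
  constructor
  · rintro ⟨h0, hdeg, hodd⟩ a
    rcases a with e | v | S
    · rw [hE]; simp only [edmondsRHS]; linarith [h0 e]
    · rw [hV]; exact hdeg v
    · rw [hS]; exact hodd S.1 S.2
  · intro h
    refine ⟨fun e => ?_, fun v => ?_, fun S hS' => ?_⟩
    · have := h (Sum.inl e); rw [hE] at this; simp only [edmondsRHS] at this; linarith
    · have := h (Sum.inr (Sum.inl v)); rwa [hV] at this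
    · have := h (Sum.inr (Sum.inr ⟨S, hS'⟩)); rwa [hS] at this

/-- **Edmonds' description is an extended formulation of size `|E| + |V| + #{odd S ⊆ V}`** ("there are
only `n` degree constraints and `O(n²)` non-negativity constraints, but `2^{Ω(n)}` odd set
inequalities"). [cite: Rothvoss2017, §1 (PDF p. 4, L17–18)] [cite: BraunPokutta2014, §2.2.1 (p0007 L100–122)] -/
theorem hasEFOfSize_edmondsPolytope_card :
    HasEFOfSize (edmondsPolytope G)
      (Fintype.card G.edgeSet + Fintype.card V + Fintype.card {S : Finset V // Odd S.card}) := by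
  have h := hasEFOfSize_of_inequalities (edmondsLHS G) (edmondsRHS G)
  rw [← edmondsPolytope_eq_setOf_dotProduct, Fintype.card_sum, Fintype.card_sum, ← add_assoc]
    at h
  exact h

/-- `xc(P_M(G)) ≤ |E| + |V| + 2^{|V|}`. [cite: Rothvoss2017, §1 (PDF p. 4, L17–18)] -/
theorem hasEFOfSize_edmondsPolytope_le :
    HasEFOfSize (edmondsPolytope G)
      (Fintype.card G.edgeSet + Fintype.card V + 2 ^ Fintype.card V) := by
  refine (hasEFOfSize_edmondsPolytope_card G).of_le ?_
  have h : Fintype.card {S : Finset V // Odd S.card} ≤ 2 ^ Fintype.card V := by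
    rw [← Fintype.card_finset]
    exact Fintype.card_subtype_le _
  omega

end General

/-! ### The complete graph: `xc(P_M(K_n)) ≤ C(n,2) + n + 2^n ≤ 2^{n+1}` and `xc(P_PM(K_n)) ≤ 2^{n+1}` -/

variable {n : ℕ}

/-- `C(n,2) + n ≤ 2^n`. [folklore] -/
private theorem choose_two_add_le_two_pow (n : ℕ) : n.choose 2 + n ≤ 2 ^ n := by
  induction n with
  | zero => simp
  | succ m ih =>
    have h2 : (m + 1).choose 2 = m.choose 1 + m.choose 2 := Nat.choose_succ_succ' m 1
    rw [Nat.choose_one_right] at h2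
    have h3 := m.lt_two_pow_self
    rw [h2, pow_succ]
    omega

/-- **`xc(P_M(K_n)) ≤ C(n,2) + n + 2^n`**: Edmonds' description of the matching polytope of the
complete graph has `C(n,2)` nonnegativity, `n` degree and at most `2^n` odd-set inequalities.
[cite: Rothvoss2017, §1 (PDF p. 4, L17–18)] [cite: Edmonds1965, §2 (1)–(3) (pp. 125–126)] -/
theorem hasEFOfSize_edmondsPolytope_top (n : ℕ) :
    HasEFOfSize (edmondsPolytope (⊤ : SimpleGraph (Fin n))) (n.choose 2 + n + 2 ^ n) := by
  classical
  have h := hasEFOfSize_edmondsPolytope_le (⊤ : SimpleGraph (Fin n))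
  rwa [← SimpleGraph.edgeFinset_card, SimpleGraph.card_edgeFinset_top_eq_card_choose_two,
    Fintype.card_fin] at h

/-- **`xc(P_M(K_n)) ≤ 2^{n+1}`.** [cite: Rothvoss2017, §1 (PDF p. 4, L17–18)] -/
theorem hasEFOfSize_edmondsPolytope_top_two_pow (n : ℕ) :
    HasEFOfSize (edmondsPolytope (⊤ : SimpleGraph (Fin n))) (2 ^ (n + 1)) := by
  refine (hasEFOfSize_edmondsPolytope_top n).of_le ?_
  have := choose_two_add_le_two_pow n
  rw [pow_succ]
  omega

/-- **`xc(P_PM(K_n)) ≤ C(n,2) + n + 2^n`**: the perfect matching polytope is the face `Σ_e x_e = n/2`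
of the matching polytope, and faces are free (`HasEFOfSize.pmPolytope_of_edmondsPolytope`).
[cite: Rothvoss2017, §1 (PDF p. 4, L17–18 and L40)] -/
theorem hasEFOfSize_pmPolytope_card (n : ℕ) : HasEFOfSize (pmPolytope n) (n.choose 2 + n + 2 ^ n) :=
  HasEFOfSize.pmPolytope_of_edmondsPolytope (hasEFOfSize_edmondsPolytope_top n)

/-- **`xc(P_PM(K_n)) ≤ 2^{n+1}`.** [cite: Rothvoss2017, §1 (PDF p. 4, L17–18 and L40)] -/
theorem hasEFOfSize_pmPolytope_two_pow (n : ℕ) : HasEFOfSize (pmPolytope n) (2 ^ (n + 1)) :=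
  HasEFOfSize.pmPolytope_of_edmondsPolytope (hasEFOfSize_edmondsPolytope_top_two_pow n)

/-- **`xc(P_PM(K_n)) = 2^{Θ(n)}` on even `n`**: Rothvoß's Theorem 1 (tree theorem `Rothvoss2017_thm1`:
`∃ c > 0`, eventually, for even `n` every EF of `P_PM(K_n)` has size `≥ 2^{cn}`) together with the
trivial upper bound `2^{n+1}` from Edmonds' description.  (The best published upper bound is
`poly(n)·2^{n/2}`, FFGT 2012, not formalised here.) [cite: Rothvoss2017, Thm. 1 (PDF p. 4) and §1 (PDF p. 4, L17–18, L26–27)] -/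
theorem Rothvoss2017_thm1_theta :
    (∃ c : ℝ, 0 < c ∧ ∀ᶠ n : ℕ in atTop, Even n → ∀ r : ℕ, HasEFOfSize (pmPolytope n) r →
      (2 : ℝ) ^ (c * n) ≤ r) ∧
    ∀ n : ℕ, HasEFOfSize (pmPolytope n) (2 ^ (n + 1)) :=
  ⟨Rothvoss2017_thm1, hasEFOfSize_pmPolytope_two_pow⟩

end Literature.Barriers.PneNP

end
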